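import Literature.Analysis.FunctionSpaces.LittlewoodPaleyMultiplierProofs
import HarnessLib

/-!
# Homogeneous Fourier multipliers on the dyadic blocks (BCD Lemma 2.2, homogeneous case)

Proof file continuing `LittlewoodPaleyMultiplierProofs.lean` (`Literature.Analysis.FunctionSpaces.truncSymbol`,
`Literature.Analysis.FunctionSpaces.exists_eLpNormDistrib_truncSymbol_lpBlock_le` = BCD Lemma 2.2 for symbols `σ ∈ C^∞(E ∖ {0})`
with
`‖D^N σ(ξ)‖ ≤ C_N ‖ξ‖^{m-N}`). It **proves** that positively homogeneous symbols satisfy those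
hypotheses, which is how the lemma is used in practice (BCD, remark following Lemma 2.2; GKP 2016,
App. B: "Bernstein's inequalities and the zero-order nature of `ℙ`"):

* `Literature.Analysis.FunctionSpaces.norm_iteratedFDeriv_le_of_homogeneous`: if `σ(cξ) = c^m σ(ξ)` (`c > 0`, `ξ ≠ 0`) then
  `‖D^N σ(ξ)‖ ≤ ‖ξ‖^{m-N} sup_{‖u‖=1} ‖D^N σ(u)‖` — the chain rule for the dilation `‖ξ‖⁻¹` on
the open
  set `E ∖ {0}`;
* `Literature.Analysis.FunctionSpaces.exists_norm_iteratedFDeriv_le_of_homogeneous`: the supremum over the unit sphere is finite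
  (compactness, continuity of `D^N σ` on `E ∖ {0}`);
* `Literature.Analysis.FunctionSpaces.exists_eLpNormDistrib_truncSymbol_lpBlock_le_of_homogeneous`: **`‖σ_j(D) Δ̇_j u‖_{L^p} ≤ C
2^{jm}
  ‖Δ̇_j u‖_{L^p}`** for every smooth-off-the-origin, degree-`m` homogeneous `σ`;
* `Literature.Analysis.FunctionSpaces.exists_eLpNormDistrib_truncSymbol_norm_rpow_lpBlock_le`: the fractional derivative `|D|^s`
  (`σ = ‖ξ‖^s`) on the blocks.

## References

* H. Bahouri, J.-Y. Chemin, R. Danchin, *Fourier Analysis and Nonlinear PDE* (2011), Lemma 2.2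
and the
  remark following it (homogeneous multipliers of degree `m`).
[cite: BahouriCheminDanchin2011, Lemma 2.2]
* I. Gallagher, G. S. Koch, F. Planchon, Comm. Math. Phys. 343 (2016), App. B.
[cite: GKP2016, App. B]
-/

noncomputable section

open MeasureTheory TemperedDistribution SchwartzMap Filter Topology Function
open scoped SchwartzMap ENNReal NNReal FourierTransform Real ContDiff

namespace Literature.Analysis.FunctionSpaces

/-! ## Homogeneous symbols satisfy the hypotheses of BCD Lemma 2.2 -/

section Homogeneous

variable {E : Type*} [NormedAddCommGroup E] [InnerProductSpace ℝ E]

/-- **Derivatives of a positively homogeneous symbol.** If `σ ∈ C^∞(E ∖ {0})` is positively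
homogeneous of degree `m` off the origin (`σ(cξ) = c^m σ(ξ)` for `c > 0`, `ξ ≠ 0`), then
`‖D^N σ(ξ)‖ ≤ ‖ξ‖^{m-N} sup_{‖u‖=1} ‖D^N σ(u)‖` for `ξ ≠ 0`: `σ = c^m σ(c⁻¹ ·)` near `ξ`, `c =
‖ξ‖`, and the
chain rule for the dilation `c⁻¹` (BCD, remark after Lemma 2.2: homogeneous Fourier multipliers of
degree `m`). [cite: BahouriCheminDanchin2011, Lemma 2.2] -/
theorem norm_iteratedFDeriv_le_of_homogeneous {σ : E → ℂ} (hσ : ContDiffOn ℝ ∞ σ {0}ᶜ) {m : ℝ}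
    (hhom : ∀ (c : ℝ), 0 < c → ∀ ξ : E, ξ ≠ 0 → σ (c • ξ) = ((c ^ m : ℝ) : ℂ) * σ ξ) (N : ℕ)
    {M : ℝ} (hM : ∀ u : E, ‖u‖ = 1 → ‖iteratedFDeriv ℝ N σ u‖ ≤ M) {ξ : E} (hξ : ξ ≠ 0) :
    ‖iteratedFDeriv ℝ N σ ξ‖ ≤ ‖ξ‖ ^ (m - N) * M := by
  set S : Set E := {0}ᶜ with hSdef
  have hS : IsOpen S := isOpen_compl_singleton
  have hSu : UniqueDiffOn ℝ S := hS.uniqueDiffOn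
  set c : ℝ := ‖ξ‖ with hc
  have hc0 : 0 < c := norm_pos_iff.2 hξ
  set L : E →L[ℝ] E := c⁻¹ • ContinuousLinearMap.id ℝ E with hL
  have hLx : ∀ y : E, L y = c⁻¹ • y := fun y => rfl
  -- `σ = c^m • (σ ∘ L)` on `S`, hence near `ξ`
  have hfun : σ =ᶠ[𝓝 ξ] fun y => ((c ^ m : ℝ) : ℂ) • (σ ∘ ⇑L) y := by
    filter_upwards [hS.mem_nhds (show ξ ∈ S from hξ)] with y hy
    have hy0 : y ≠ 0 := hy
    have key := hhom c hc0 (c⁻¹ • y) (smul_ne_zero (inv_ne_zero hc0.ne') hy0)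
    rw [smul_smul, mul_inv_cancel₀ hc0.ne', one_smul] at key
    simp only [comp_apply, smul_eq_mul, hLx]
    exact key
  rw [(hfun.iteratedFDeriv ℝ N).eq_of_nhds]
  -- pull out the constant and use the chain rule on the open set `S`
  have hpre : ⇑L ⁻¹' S = S := by
    ext y
    simp only [Set.mem_preimage, hSdef, Set.mem_compl_iff, Set.mem_singleton_iff, hLx, smul_eq_zero,
      inv_eq_zero, hc0.ne', false_or]
  have hσL : ContDiffOn ℝ ∞ (σ ∘ ⇑L) S := by
    rw [← hpre]; exact hσ.comp L.contDiff.contDiffOn (fun y hy => hy)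
  have hξS : ξ ∈ S := hξ
  have hcomp : ContDiffAt ℝ ∞ (σ ∘ ⇑L) ξ := hσL.contDiffAt (hS.mem_nhds hξS)
  rw [show (fun y => ((c ^ m : ℝ) : ℂ) • (σ ∘ ⇑L) y) = ((c ^ m : ℝ) : ℂ) • (σ ∘ ⇑L) from rfl,
    iteratedFDeriv_const_smul_apply (hcomp.of_le (mod_cast le_top)), norm_smul,
    ← iteratedFDerivWithin_of_isOpen N hS hξS]
  have hchain := ContinuousLinearMap.iteratedFDerivWithin_comp_right L hσ hSu (by rwa [hpre]) (x := ξ)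
    (by rw [← Set.mem_preimage, hpre]; exact hξS) (i := N) (mod_cast le_top)
  rw [hpre] at hchain
  rw [hchain]
  have hLnorm : ‖L‖ ≤ c⁻¹ := by
    rw [hL, norm_smul, Real.norm_of_nonneg (inv_nonneg.2 hc0.le)]
    exact (mul_le_mul_of_nonneg_left ContinuousLinearMap.norm_id_le (inv_nonneg.2 hc0.le)).trans
      (mul_one _).le
  have hLξ : L ξ = c⁻¹ • ξ := rfl
  have hunit : ‖L ξ‖ = 1 := by rw [hLξ, norm_smul, Real.norm_of_nonneg (inv_nonneg.2 hc0.le), hc,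
    inv_mul_cancel₀ hc0.ne']
  have hLξS : L ξ ∈ S := by rw [← Set.mem_preimage, hpre]; exact hξS
  calc ‖((c ^ m : ℝ) : ℂ)‖ * ‖(iteratedFDerivWithin ℝ N σ S (L ξ)).compContinuousLinearMap fun _ => L‖
      ≤ ‖((c ^ m : ℝ) : ℂ)‖ * (‖iteratedFDerivWithin ℝ N σ S (L ξ)‖ * ∏ _i : Fin N, ‖L‖) := by
        gcongr
        exact ContinuousMultilinearMap.norm_compContinuousLinearMap_le _ _
    _ ≤ c ^ m * (M * (c⁻¹) ^ N) := by
        rw [Complex.norm_real, Real.norm_of_nonneg (Real.rpow_nonneg hc0.le _), Finset.prod_const,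
          Finset.card_univ, Fintype.card_fin, iteratedFDerivWithin_of_isOpen N hS hLξS]
        gcongr
        · exact le_trans (norm_nonneg _) (hM _ hunit)
        · exact hM _ hunit
    _ = ‖ξ‖ ^ (m - N) * M := by
        rw [hc, Real.rpow_sub hc0, Real.rpow_natCast, inv_pow]
        ring

variable [FiniteDimensional ℝ E]

/-- **Homogeneous symbols have the BCD Lemma 2.2 bounds**: for `σ ∈ C^∞(E ∖ {0})` positively
homogeneous of degree `m`, every derivative satisfies `‖D^N σ(ξ)‖ ≤ C_N ‖ξ‖^{m-N}` (`ξ ≠ 0`), with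
`C_N = sup_{‖u‖=1} ‖D^N σ(u)‖ < ∞` by compactness of the unit sphere.
[cite: BahouriCheminDanchin2011, Lemma 2.2] -/
theorem exists_norm_iteratedFDeriv_le_of_homogeneous {σ : E → ℂ} (hσ : ContDiffOn ℝ ∞ σ {0}ᶜ) {m : ℝ}
    (hhom : ∀ (c : ℝ), 0 < c → ∀ ξ : E, ξ ≠ 0 → σ (c • ξ) = ((c ^ m : ℝ) : ℂ) * σ ξ) (N : ℕ) :
    ∃ C : ℝ, ∀ ξ : E, ξ ≠ 0 → ‖iteratedFDeriv ℝ N σ ξ‖ ≤ C * ‖ξ‖ ^ (m - N) := by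
  have hS : IsOpen ({0}ᶜ : Set E) := isOpen_compl_singleton
  have hcont : ContinuousOn (iteratedFDerivWithin ℝ N σ {0}ᶜ) {0}ᶜ :=
    hσ.continuousOn_iteratedFDerivWithin (mod_cast le_top) hS.uniqueDiffOn
  have hsph : Metric.sphere (0 : E) 1 ⊆ {0}ᶜ := fun u hu h0 => by
    rw [Set.mem_singleton_iff] at h0
    rw [h0, mem_sphere_zero_iff_norm, norm_zero] at hu
    exact zero_ne_one hu
  obtain ⟨M, hM⟩ := (isCompact_sphere (0 : E) 1).exists_bound_of_continuousOn (hcont.mono hsph)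
  refine ⟨M, fun ξ hξ => ?_⟩
  rw [mul_comm]
  refine norm_iteratedFDeriv_le_of_homogeneous hσ hhom N (fun u hu => ?_) hξ
  have huS : u ∈ Metric.sphere (0 : E) 1 := mem_sphere_zero_iff_norm.2 hu
  have := hM u huS
  rwa [iteratedFDerivWithin_of_isOpen N hS (hsph huS)] at this

variable [MeasurableSpace E] [BorelSpace E] {F : Type*} [NormedAddCommGroup F] [NormedSpace ℂ F]
  [CompleteSpace F]

/-- **BCD Lemma 2.2 for homogeneous symbols** ("homogeneous Fourier multipliers of degree `m` act on
functions with Fourier support in an annulus `2^j 𝒞` like multiplication by `2^{jm}`"): for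
`σ ∈ C^∞(E ∖ {0})` positively homogeneous of degree `m` and `1 ≤ p ≤ ∞` there is `C` with
`‖σ_j(D) Δ̇_j u‖_{L^p} ≤ C 2^{jm} ‖Δ̇_j u‖_{L^p}` for all `j ∈ ℤ`, `u ∈ 𝓢'(E, F)` (`σ_j =
Literature.truncSymbol σ j`,
the block truncation). Examples: `|ξ|^s` (`m = s`), Riesz transforms `ξ_k/|ξ|` and the Leray
projector
symbol `δ_{kl} - ξ_kξ_l/|ξ|²` (`m = 0`), `(δ_{kl} - ξ_kξ_l/|ξ|²) ξ_n` (`m = 1`, the operator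
`ℙ∇·` of
GKP 2016, App. B, (B.5)). [cite: BahouriCheminDanchin2011, Lemma 2.2] -/
theorem exists_eLpNormDistrib_truncSymbol_lpBlock_le_of_homogeneous (p : ℝ≥0∞) [Fact (1 ≤ p)]
    {σ : E → ℂ} (hσ : ContDiffOn ℝ ∞ σ {0}ᶜ) {m : ℝ}
    (hhom : ∀ (c : ℝ), 0 < c → ∀ ξ : E, ξ ≠ 0 → σ (c • ξ) = ((c ^ m : ℝ) : ℂ) * σ ξ) :
    ∃ C : ℝ≥0, ∀ (j : ℤ) (u : 𝓢'(E, F)),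
      eLpNormDistrib p (fourierMultiplierCLM F (truncSymbol σ j) (lpBlock j u)) ≤
        C * (2 : ℝ≥0∞) ^ ((j : ℝ) * m) * eLpNormDistrib p (lpBlock j u) := by
  choose Cσ hCσ using fun N : ℕ => exists_norm_iteratedFDeriv_le_of_homogeneous hσ hhom N
  exact exists_eLpNormDistrib_truncSymbol_lpBlock_le p hσ (fun N ξ hξ => hCσ N ξ hξ)

/-- **The fractional derivative symbol `|ξ|^s` is admissible**: `ξ ↦ ‖ξ‖^s` is smooth off the origin
and positively homogeneous of degree `s`, so `‖(|D|^s)_j Δ̇_j u‖_{L^p} ≤ C 2^{js} ‖Δ̇_j u‖_{L^p}`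
(BCD Lemma 2.2, homogeneous case `m = s`: `|D|^s` on the blocks).
[cite: BahouriCheminDanchin2011, Lemma 2.2] -/
theorem exists_eLpNormDistrib_truncSymbol_norm_rpow_lpBlock_le (p : ℝ≥0∞) [Fact (1 ≤ p)] (s : ℝ) :
    ∃ C : ℝ≥0, ∀ (j : ℤ) (u : 𝓢'(E, F)),
      eLpNormDistrib p (fourierMultiplierCLM F (truncSymbol (fun ξ : E => ((‖ξ‖ ^ s : ℝ) : ℂ)) j)
        (lpBlock j u)) ≤ C * (2 : ℝ≥0∞) ^ ((j : ℝ) * s) * eLpNormDistrib p (lpBlock j u) := by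
  refine exists_eLpNormDistrib_truncSymbol_lpBlock_le_of_homogeneous p ?_ ?_
  · intro ξ hξ
    have hξ0 : ξ ≠ 0 := hξ
    have h1 : ContDiffAt ℝ ∞ (fun ξ : E => ‖ξ‖ ^ s) ξ := (contDiffAt_norm ℝ hξ0).rpow_const_of_ne
      (norm_ne_zero_iff.2 hξ0)
    exact (Complex.ofRealCLM.contDiff.contDiffAt.comp ξ h1).contDiffWithinAt
  · intro c hc ξ _
    rw [norm_smul, Real.norm_of_nonneg hc.le, Real.mul_rpow hc.le (norm_nonneg _), Complex.ofReal_mul]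

end Homogeneous

end Literature.Analysis.FunctionSpaces
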